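import Summits.BirchSwinnertonDyer.BirchSwinnertonDyer.Theorems.KolyvaginDepthDoorDepthTableKuriharaDecisive563a1
import Summits.BirchSwinnertonDyer.BirchSwinnertonDyer.Theorems.KolyvaginDepthDoorDepthTableKuriharaSocket563a1
import Summits.BirchSwinnertonDyer.BirchSwinnertonDyer.Theorems.KolyvaginDepthDoorDepthTableKuriharaDecisivePair563a1
import HarnessLib

/-!
# Route `KolyvaginDepthDoor`, crux `KolyvaginDepthSupplyKN` (stmt-BirchSwinnertonDyer-22820) —
# DEPTH TABLE v22, ROW `563a1` @ `p = 7`: «ONE ANTICYCLOTOMIC BIT ⟺ TWO PRESCRIBED CYCLOTOMIC RESIDUES» — the row read with NO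
# record claim as a hypothesis: bit ⟺ (unit `δ̃_{8149}(E)` ∧ unit `δ̃_{ℓ★}(T₀)`), both Kurihara numbers at PRESCRIBED levels

Helper file of the lead prover of line `levelone` (kdd-p1 g26; `--supports stmt-BirchSwinnertonDyer-22820 --as helper`);
it closes nothing and BSD is NOT proved by it.

v19–v21 (`twistKuriharaBit_iff_unit_281`) read this row as «bit ⟺ unit at the decisive prime of the twist» GRANTED the E-side record claim `hδE`
(the tree record `cert_563a1` @ level `8149`) as a hypothesis. v22 (`sha_inf_torsionBy_eq_bot_iff_kuriharaClaim_7_8149`, file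
`…KuriharaDecisivePair563a1`: «`Ш(E)[7] = 0` ⟺ unit `δ̃_{8149}(E)`», kernel localisation matrix) lets the claim move to the
right-hand side: the depth-table bit at `(E, p, K)` holds IF AND ONLY IF BOTH prescribed residues are units. (⟹: the ♠-cell exact
reading `kolyvaginClass_prime_ne_zero_iff_shaTrivial_twistSelmer_of_rank_two_of_lemma84` — (γ) + W. Zhang L8.4 (1)/9.1, with the
socket's kernel side conditions — gives `Ш(E)[7] = 0`, v22 turns it into the E-unit, v19–v21 give the twist unit; ⟸: v19–v21 with
`hδE :=` the E-unit.) CONDITIONAL on the named facts displayed (now including `hSakR`); per curve; nothing class-wide; BSD is NOT proved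
by any of this.

References: [Sakamoto2022pSelmer] Lemma 4.4, Lemma 4.6 (1), Thm. 1.2, Thm. 1.5; [Kim2022StructureSelmer] Thm. 1.11; [WZhang2014] Lemma 8.4 (1),
Thm. 9.1; [GrossLMS1991] Prop. 3.7 (2); [CremonaAlgorithms1997] Table 1 (563a1).
-/

set_option linter.dupNamespace false

noncomputable section

open scoped Classical NumberField

namespace Summit.BirchSwinnertonDyer.BirchSwinnertonDyer.Theorems.KolyvaginDepthDoor

open Literature.NumberTheory.EllipticCurves Literature.NumberTheory.EllipticCurves.ModularForms
  WeierstrassCurve NumberField IsDedekindDomain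
open Summit.BirchSwinnertonDyer.BirchSwinnertonDyer.Theorems
open Summit.BirchSwinnertonDyer.BirchSwinnertonDyer.Rank2Observatory

namespace C563a1

/-- **ROW `563a1` @ `7`, v22: bit ⟺ (unit `δ̃_{8149}(E)` ∧ unit at the decisive prime of the twist)** — for every imaginary
quadratic `K` of the row's discriminant: «some frame, some Kolyvagin PRIME `ℓ`, some Kolyvagin–Heegner datum of conductor `ℓ` with
`c_1(ℓ) ≠ 0`» IF AND ONLY IF «every admissible datum of `E` has a unit mod-`7` Kurihara number AT `8149`» AND «every admissible datum
of the twist model has a unit at the decisive prime» — `twistKuriharaBit_iff_unit_281` with its hypothesis `hδE` discharged BOTH WAYS by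
`sha_inf_torsionBy_eq_bot_iff_kuriharaClaim_7_8149` and the ♠-cell exact reading of the socket `kolyvaginPrime_iff_twistKuriharaBit_7_neg8`. No record claim is assumed.
CONDITIONAL on the named facts; per curve; BSD is not proved by it. [cite: Sakamoto2022pSelmer, Lemma 4.4, Lemma 4.6 (1)]
[cite: Kim2022StructureSelmer, Thm. 1.11] [cite: WZhang2014, Lemma 8.4 (1) (p. 236), Thm. 9.1 (p. 240)] [cite: GrossLMS1991, Prop. 3.7 (2)]
[cite: CremonaAlgorithms1997, Table 1 (563a1)] -/
theorem kolyvaginPrime_iff_kuriharaUnits_7_8149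
    (h372 : GrossLMS1991.prop37_2_frobeniusCongruence)
    (h84 : Literature.NumberTheory.EllipticCurves.WZhang2014_lemma84_exists_minimal_kolyvaginClass_one_selmerCard)
    (hKim : Kim2022_card_selmerGroup_le_pow_of_kuriharaNumber_ne_zero)
    (hSak1 : Sakamoto2022_card_selmerGroup_eq_pow_of_isDeltaMinimal)
    (hSak2 : Sakamoto2022_exists_cyclicLevel_kuriharaNumber_ne_zero)
    (hSak3 : Literature.NumberTheory.EllipticCurves.Sakamoto2022_kuriharaNumber_prime_ne_zero_of_localNondivisible)
    (hnf : exists_isNewformOf) (hMaz : mazur_not_dvd_maninConstant_of_odd)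
    (K : Type) [Field K] [NumberField K] (hK : IsImaginaryQuadratic K) (hD : NumberField.discr K = -8)
    (hSakR : Sakamoto2022_kuriharaNumber_ne_zero_of_localizationInjective) :
    haveI := isElliptic_c563a1; haveI := isGloballyMinimal_c563a1;
    haveI : NeZero (((⟨1, 1, 1, -15, 16⟩ : WeierstrassCurve ℤ).map (Int.castRingHom ℚ)).conductorNorm ℤ) := neZero_conductorNorm_of_isElliptic _;
    haveI := minTwist8_isElliptic; haveI := minTwist8_isGloballyMinimal;
    haveI : NeZero (((⟨0, -1, 0, -961, -11167⟩ : WeierstrassCurve ℤ).map (Int.castRingHom ℚ)).conductorNorm ℤ) := neZero_conductorNorm_of_isElliptic _;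
    haveI := Fact.mk (by norm_num : Nat.Prime 7);
    (∃ (Dt : ModularParametrizationData ((⟨1, 1, 1, -15, 16⟩ : WeierstrassCurve ℤ).map (Int.castRingHom ℚ)) (((⟨1, 1, 1, -15, 16⟩ : WeierstrassCurve ℤ).map (Int.castRingHom ℚ)).conductorNorm ℤ)) (β : ℤ)
      (ι : K →+* ℂ) (ℓ : ℕ) (d : KolyvaginHeegnerData Dt β ι ℓ),
      ℓ.Prime ∧ Zhang2014.IsKolyvaginPrime (((⟨1, 1, 1, -15, 16⟩ : WeierstrassCurve ℤ).map (Int.castRingHom ℚ)).conductorNorm ℤ) ((⟨1, 1, 1, -15, 16⟩ : WeierstrassCurve ℤ).map (Int.castRingHom ℚ)) K 7 ℓ ∧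
        d.kolyvaginClass (p := 7) (by norm_num) 1 ≠ 0)
      ↔
    ((haveI := isElliptic_c563a1; haveI := isGloballyMinimal_c563a1;
      haveI : NeZero (((⟨1, 1, 1, -15, 16⟩ : WeierstrassCurve ℤ).map (Int.castRingHom ℚ)).conductorNorm ℤ) := neZero_conductorNorm_of_isElliptic _;
      haveI := Fact.mk (by norm_num : Nat.Prime 7);
      ∀ (D : ModularParametrizationData ((⟨1, 1, 1, -15, 16⟩ : WeierstrassCurve ℤ).map (Int.castRingHom ℚ)) (((⟨1, 1, 1, -15, 16⟩ : WeierstrassCurve ℤ).map (Int.castRingHom ℚ)).conductorNorm ℤ)), ¬ ((7 : ℕ) : ℤ) ∣ D.maninConstant →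
        (∃ u : ℚ, ‖(u : ℚ_[7])‖ = 1 ∧ ((⟨1, 1, 1, -15, 16⟩ : WeierstrassCurve ℤ).map (Int.castRingHom ℚ)).realPeriodRat = u * plusPeriod D.f) →
        ∃ ψ : (ℓ : ℕ) → (ZMod ℓ)ˣ →* Multiplicative (ZMod 7),
          (∀ ℓ ∈ (8149 : ℕ).primeFactors, Function.Surjective (ψ ℓ)) ∧ kuriharaNumber D.f 7 8149 ψ ≠ 0) ∧
    (∀ (D : ModularParametrizationData ((⟨0, -1, 0, -961, -11167⟩ : WeierstrassCurve ℤ).map (Int.castRingHom ℚ))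
          (((⟨0, -1, 0, -961, -11167⟩ : WeierstrassCurve ℤ).map (Int.castRingHom ℚ)).conductorNorm ℤ)),
        ¬ ((7 : ℕ) : ℤ) ∣ D.maninConstant →
        (∃ u : ℚ, ‖(u : ℚ_[7])‖ = 1 ∧
          ((⟨0, -1, 0, -961, -11167⟩ : WeierstrassCurve ℤ).map (Int.castRingHom ℚ)).realPeriodRat = u * plusPeriod D.f) →
        ∃ ψ : (q : ℕ) → (ZMod q)ˣ →* Multiplicative (ZMod 7),
          (∀ q ∈ (281 : ℕ).primeFactors, Function.Surjective (ψ q)) ∧ kuriharaNumber D.f 7 281 ψ ≠ 0) )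
 := by
  haveI := isElliptic_c563a1
  haveI := isGloballyMinimal_c563a1
  haveI iNZ : NeZero (((⟨1, 1, 1, -15, 16⟩ : WeierstrassCurve ℤ).map (Int.castRingHom ℚ)).conductorNorm ℤ) :=
    neZero_conductorNorm_of_isElliptic _
  haveI := minTwist8_isElliptic
  haveI := minTwist8_isGloballyMinimal
  haveI iNZT : NeZero (((⟨0, -1, 0, -961, -11167⟩ : WeierstrassCurve ℤ).map (Int.castRingHom ℚ)).conductorNorm ℤ) :=
    neZero_conductorNorm_of_isElliptic _
  haveI iP := Fact.mk (by norm_num : Nat.Prime 7)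
  have hsur : ((⟨1, 1, 1, -15, 16⟩ : WeierstrassCurve ℤ).map (Int.castRingHom ℚ)).HasSurjectiveModNGaloisRep ((7 : ℕ) : ℤ) := by
    simpa using hasSurjectiveModNGaloisRep_7
  have htower : ∀ k : ℕ, ((⟨1, 1, 1, -15, 16⟩ : WeierstrassCurve ℤ).map (Int.castRingHom ℚ)).HasSurjectiveModNGaloisRep ((7 : ℕ) ^ k : ℕ) :=
    serre_hasSurjectiveModNGaloisRep_pow_holds _ 7 (by norm_num) hsur
  have hsp := spadeOne_of_five_le 7 (by norm_num)
  have hS2 : ¬ Squarefree (((⟨1, 1, 1, -15, 16⟩ : WeierstrassCurve ℤ).map (Int.castRingHom ℚ)).conductorNorm ℤ) →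
      (∃ (ℓ : ℕ) (_ : Fact ℓ.Prime), ((⟨1, 1, 1, -15, 16⟩ : WeierstrassCurve ℤ).map (Int.castRingHom ℚ)).HasMultiplicativeReductionAtPrime ℓ ∧
          ¬ 7 ∣ padicValInt ℓ ((⟨1, 1, 1, -15, 16⟩ : WeierstrassCurve ℤ).map (Int.castRingHom ℚ)).minimalDiscriminantInt) ∧
        ∃ (ℓ₁ ℓ₂ : ℕ) (_ : Fact ℓ₁.Prime) (_ : Fact ℓ₂.Prime), ℓ₁ ≠ ℓ₂ ∧
          ((⟨1, 1, 1, -15, 16⟩ : WeierstrassCurve ℤ).map (Int.castRingHom ℚ)).HasMultiplicativeReductionAtPrime ℓ₁ ∧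
          ((⟨1, 1, 1, -15, 16⟩ : WeierstrassCurve ℤ).map (Int.castRingHom ℚ)).HasMultiplicativeReductionAtPrime ℓ₂ :=
    fun hns ↦ absurd ((((⟨1, 1, 1, -15, 16⟩ : WeierstrassCurve ℤ).map (Int.castRingHom ℚ))).isSemistable_iff_squarefree_conductorNorm.mp hsp.2) hns
  have hH := satisfiesHeegnerHypothesis_conductorNorm_of_intModel intModel K hK.1 hD heegner_neg8
  have hD3 : NumberField.discr K ≠ -3 := by rw [hD]; norm_num
  have hD4 : NumberField.discr K ≠ -4 := by rw [hD]; norm_num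
  have hpD : ¬ (((7 : ℕ) : ℤ) ∣ NumberField.discr K) := by rw [hD]; decide
  have hr2 := Summit.BirchSwinnertonDyer.BirchSwinnertonDyer.Rank2Observatory.C563a1.mordellWeilRank_eq_two
  have hexact := kolyvaginClass_prime_ne_zero_iff_shaTrivial_twistSelmer_of_rank_two_of_lemma84 h372 h84 _ not_hasCM 7 (by norm_num) goodOrdinary_7.1 goodOrdinary_7.2 htower (kodairaNeron_of_five_le 7 (by norm_num)) hsp.1 hS2 K hK hD3 hD4 hpD hH hr2
  constructor
  · intro hbit
    have hsha := (hexact.mp hbit).1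
    have hE := (sha_inf_torsionBy_eq_bot_iff_kuriharaClaim_7_8149 hKim hnf hMaz hSakR).mp hsha
    exact ⟨hE, (twistKuriharaBit_iff_unit_281 h372 h84 hKim hSak1 hSak2 hSak3 hnf hMaz K hK hD hE).mp hbit⟩
  · rintro ⟨hE, hT⟩
    exact (twistKuriharaBit_iff_unit_281 h372 h84 hKim hSak1 hSak2 hSak3 hnf hMaz K hK hD hE).mpr hT

end C563a1

end Summit.BirchSwinnertonDyer.BirchSwinnertonDyer.Theorems.KolyvaginDepthDoor

end
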